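import Literature.AlgebraicGeometry.HodgeTheory.SmallChowGroupsHodgeConjectureProofs
import Literature.AlgebraicGeometry.HodgeTheory.ComplexOrientationDegreeFormulaHolds
import Literature.AlgebraicGeometry.HodgeTheory.HardLefschetzNFoldHolds
import Literature.AlgebraicGeometry.HodgeTheory.LefschetzOneOneHolds
import Literature.AlgebraicGeometry.Resolution.ProjectiveResolutionProofs
import HarnessLib

/-!
# Vial 2013, Thm. 7.1 (i): the Hodge conjecture for varieties with small Chow groups — PROVED

Family `hodge`, layer `Literature/AlgebraicGeometry/HodgeTheory`. DISCHARGE of the named fact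
`Vial2013_hodgeConjectureFor_of_chowGroups_rank_le_one` (`SmallChowGroupsHodgeConjecture.lean`: a smooth
projective complex `d`-fold whose Chow groups `CH_i(X_L) ⊗ ℚ`, `i ≤ ⌊(d−4)/2⌋`, have dimension `≤ 1`
over every algebraically closed `L ⊇ ℂ` satisfies `HodgeConjectureFor d X`; Vial 2013 Thm. 7.1 (i),
Laterveer 1998). The tree's assembly `…_of_isGysinHodgeCompatible` (everything else proved:
generalised decomposition of the diagonal, Hodge models, Lefschetz `(1,1)`, hard Lefschetz, Hironaka)
took a Gysin / cycle-class formalism with Hodge-compatible Gysin morphisms as a parameter; one EXISTS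
unconditionally since `ComplexOrientationDegreeFormulaHolds`
(`exists_gysinFormalism_isGysinHodgeCompatible_complexOrientation_holds`).

## References

* [Vial2013] Ch. Vial, Algebraic cycles and fibrations, Doc. Math. 18 (2013), Thm. 7.1 (i).
* [Laterveer1998] R. Laterveer, Algebraic varieties with small Chow groups, J. Math. Kyoto Univ. 38 (1998).
* [VoisinHodgeII2003] C. Voisin, Hodge Theory and Complex Algebraic Geometry II, Thm. 10.29, Thm. 10.31.
-/

noncomputable section

namespace Literature.AlgebraicGeometry.HodgeTheory

section HodgeTheory

/-- **Vial 2013, Thm. 7.1 (i) (Laterveer 1998), PROVED**: a smooth projective complex variety whose low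
Chow groups have rank `≤ 1` over every algebraically closed overfield satisfies the Hodge conjecture
(discharge of `Vial2013_hodgeConjectureFor_of_chowGroups_rank_le_one` through
`…_of_isGysinHodgeCompatible` over the unconditional Gysin formalism of the complex orientations,
Hironaka, Hodge models, Lefschetz `(1,1)` and hard Lefschetz — all theorems of the tree).
[cite: Vial2013, Thm 7.1 (i)] [cite: Laterveer1998, main theorem, as quoted in Vial2013 Thm 7.1] -/
theorem Vial2013_hodgeConjectureFor_of_chowGroups_rank_le_one_holds :
    Vial2013_hodgeConjectureFor_of_chowGroups_rank_le_one := by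
  obtain ⟨G, hG⟩ := exists_gysinFormalism_isGysinHodgeCompatible_complexOrientation_holds
  exact Vial2013_hodgeConjectureFor_of_chowGroups_rank_le_one_of_isGysinHodgeCompatible G hG
    Resolution.Hironaka1964_projective_holds (fun _ _ ↦ nonempty_hodgeModel_holds)
    lefschetzOneOne_rational_holds nonempty_hardLefschetzNFold_holds

end HodgeTheory

end Literature.AlgebraicGeometry.HodgeTheory

end
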